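import Mathlib
import HarnessLib
import Literature.Analysis.FluidPDE.SelfSimilar
import Literature.Analysis.FluidPDE.VectorCalculus
import Literature.Analysis.FluidPDE.Vorticity
import Literature.Analysis.FluidPDE.VorticityEquation
import Literature.Analysis.UnboundedOperators.HeatKernel
import Summits.NavierStokesRegularity.NavierStokesRegularity.Theorems.ChiralWindowDoorClassDerivDecay
import Summits.NavierStokesRegularity.NavierStokesRegularity.Theorems.ImplosionDoorPassiveRadialVorticityChiTransport
import Summits.NavierStokesRegularity.NavierStokesRegularity.Theorems.ImplosionDoorPassiveRadialVorticityWashout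

/-!
# `ImplosionDoor.PassiveRadialVorticity` (stmt-NavierStokesRegularity-25305) — line `birth`,
# research stub `stub_farPastWashout` PROVED: the radial vorticity moment of a sphere-tangential
# Type-I ancient Oseen-mild profile is washed out from the far past

Registered stub of the skeleton of record `Cruxes/PassiveRadialVorticity/Lines/birth` (planner ns-idea-6,
`PassiveRadialVorticity_birth_g3.lean`, sha 7fb62332…), VERBATIM, so the line's `sorry` at `stub_farPastWashout`
closes by `exact …Theorems.ImplosionDoorPassiveRadialVorticityStubFarPastWashout.stub_farPastWashout`.

STATEMENT.  For a profile `v` of the route's Type-I ancient Oseen-mild class that is sphere-tangential, and any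
`C′` with `‖curl v(s)(y)‖ ≤ C′/(−s)` (the line's other stub, landed), the radial vorticity moment
`χ(t,y) = ⟪curl v(t)(y), y⟫` satisfies `|χ(t,y)| ≤ δ` for every `δ > 0` (i.e. `χ ≡ 0`).

PROOF.  (1) The class is classical on `(−∞,0)` (tree `…ChiralWindowDoorClassDerivDecay.exists_classical_of_class`)
and hence solves the vorticity formulation (`isVorticitySolutionOn_zero_force`).  (2) χ-TRANSPORT (helper
`…ChiTransport.hasDerivAt_chi`): `∂ₜχ = Δχ − v·∇χ` — tangency makes the stretching term cancel.  (3) FAR-PAST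
WASHOUT (helper `…Washout.abs_mul_weight_le`): Friedman's weak maximum principle for the Gaussian gauge
`χ·(S−t)²e^{−|y|²/(4(S−t))}` on `[−S, t]` gives `|χ(t,y)|(S−t)²e^{−|y|²/(4(S−t))} ≤ 4C′S√(2S)`; with
`S = |y|² + (18C′/δ)² − t + 1` this is `≤ δ`.

HONEST FRAMING: a statement about HYPOTHETICAL blow-up profiles (KNSS-type ancient mild solutions under the door's
tangency hypothesis); nothing here bears on Navier–Stokes regularity; no summit statement is proved.
-/

noncomputable section

-- the summit and its single sub-problem share the name (CONVENTIONS §1), as in every Theorems file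
set_option linter.dupNamespace false

namespace Summit.NavierStokesRegularity.NavierStokesRegularity.Theorems.ImplosionDoorPassiveRadialVorticityStubFarPastWashout

open Set Function
open scoped RealInnerProductSpace InnerProductSpace Laplacian
open Literature.Analysis Literature.Analysis.FluidPDE
open Summit.NavierStokesRegularity.NavierStokesRegularity.Theorems.ChiralWindowDoorClassDerivDecay (exists_classical_of_class)
open Summit.NavierStokesRegularity.NavierStokesRegularity.Theorems.ImplosionDoorPassiveRadialVorticityChiTransport
open Summit.NavierStokesRegularity.NavierStokesRegularity.Theorems.ImplosionDoorPassiveRadialVorticityWashout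

/-- **Stub `stub_farPastWashout` of line `birth` (crux `PassiveRadialVorticity`, stmt-25305), VERBATIM**: for a
sphere-tangential profile of the route's Type-I ancient Oseen-mild class with the Type-I vorticity bound
`‖curl v(s)‖ ≤ C′/(−s)`, the radial vorticity moment `⟪curl v(t)(y), y⟫` is `≤ δ` in absolute value for every
`δ > 0` (χ-transport + Friedman's maximum principle in the Gaussian gauge; module docstring).
[cite: Friedman1964, Ch. 2 §4 Lemma 5; folklore] -/
theorem stub_farPastWashout : ∀ (C : ℝ) (v : ℝ → EuclideanSpace ℝ (Fin 3) → EuclideanSpace ℝ (Fin 3)), Literature.Analysis.FluidPDE.HasTypeITimeDecay C v → ContinuousOn (Function.uncurry v) (Set.Iio (0 : ℝ) ×ˢ Set.univ) → (∀ s t : ℝ, s < t → t < 0 → ∀ x, v t x = Literature.Analysis.UnboundedOperators.heatExtension (v s) (t - s) x - Literature.Analysis.FluidPDE.oseenDuhamel 1 s v v t x) → (∀ t < 0, Literature.Analysis.FluidPDE.VectorCalculus.IsDivFree (v t)) → (∀ s < 0, ∀ y, ⟪v s y, y⟫_ℝ = 0) → ∀ C' : ℝ, (∀ s < 0, ∀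 y, ‖Literature.Analysis.FluidPDE.curl (v s) y‖ ≤ C' / (-s)) → ∀ t < 0, ∀ y, ∀ δ : ℝ, 0 < δ → |⟪Literature.Analysis.FluidPDE.curl (v t) y, y⟫_ℝ| ≤ δ := by
  intro C v hrate hcont hmild hdiv htan C' hC' t₀ ht₀ y₀ δ hδ
  -- (1) the class is classical, hence a vorticity solution on `(−∞,0)`
  obtain ⟨q, hcl⟩ := exists_classical_of_class hrate hcont hmild hdiv
  have hV : IsVorticitySolutionOn (Iio (0 : ℝ)) 1 v :=
    hcl.isVorticitySolutionOn_zero_force isOpen_Iio.uniqueDiffOn (by rw [interior_Iio]; exact subset_closure)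
  -- (2) the radial vorticity moment and its transport equation
  set χ : ℝ → EuclideanSpace ℝ (Fin 3) → ℝ := fun t y => ⟪curl (v t) y, y⟫ with hχdef
  have hχ : IsSmoothSpaceTimeOn (Iio (0 : ℝ)) χ := isSmoothSpaceTimeOn_chi hcl.smooth_velocity isOpen_Iio.uniqueDiffOn
  have hχeq : ∀ t < (0 : ℝ), ∀ y, HasDerivAt (fun s => χ s y) ((Δ (χ t)) y - fderiv ℝ (χ t) y (v t y)) t :=
    fun t ht y => hasDerivAt_chi hV htan ht y
  -- the Type-I size of `χ`
  have hC'0 : 0 ≤ C' := by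
    have h := hC' (-1) (by norm_num) 0
    rw [neg_neg, div_one] at h
    exact (norm_nonneg _).trans h
  have hgrow : ∀ t < (0 : ℝ), ∀ y, |χ t y| ≤ C' * ‖y‖ / (-t) := by
    intro t ht y
    calc |χ t y| = |⟪curl (v t) y, y⟫| := rfl
      _ ≤ ‖curl (v t) y‖ * ‖y‖ := abs_real_inner_le_norm _ _
      _ ≤ C' / (-t) * ‖y‖ := mul_le_mul_of_nonneg_right (hC' t ht y) (norm_nonneg _)
      _ = C' * ‖y‖ / (-t) := by ring
  -- (3) far-past washout with `S = |y₀|² + (18C′/δ)² − t₀ + 1`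
  set S : ℝ := ‖y₀‖ ^ 2 + (18 * C' / δ) ^ 2 + (-t₀) + 1 with hSdef
  have hm : 0 < -t₀ := neg_pos.2 ht₀
  have hS : -t₀ < S := by rw [hSdef]; nlinarith [sq_nonneg ‖y₀‖, sq_nonneg (18 * C' / δ)]
  have hS1 : 1 ≤ S := by rw [hSdef]; nlinarith [sq_nonneg ‖y₀‖, sq_nonneg (18 * C' / δ)]
  have hS0 : 0 < S := by linarith
  have hSy : ‖y₀‖ ^ 2 ≤ S := by rw [hSdef]; nlinarith [sq_nonneg (18 * C' / δ)]
  have hSC : (18 * C' / δ) ^ 2 ≤ S := by rw [hSdef]; nlinarith [sq_nonneg ‖y₀‖]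
  have hb := abs_mul_weight_le hχ hχeq htan hC'0 hgrow ht₀ y₀ hS
  -- lower bound for the gauge at `(t₀, y₀)`: `(S − t₀)² e^{−|y₀|²/(4(S−t₀))} ≥ S²/3`
  have hSt : S ≤ S - t₀ := by linarith
  have hexp : 1 / 3 ≤ Real.exp (-(‖y₀‖ ^ 2 / (4 * (S - t₀)))) := by
    have hx : ‖y₀‖ ^ 2 / (4 * (S - t₀)) ≤ 1 := by
      rw [div_le_one (by linarith)]
      nlinarith
    have h1 : Real.exp (-1) ≤ Real.exp (-(‖y₀‖ ^ 2 / (4 * (S - t₀)))) := Real.exp_le_exp.2 (by linarith)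
    refine le_trans ?_ h1
    rw [Real.exp_neg, ← one_div]
    exact one_div_le_one_div_of_le (Real.exp_pos 1) (by linarith [Real.exp_one_lt_d9])
  have hw : S ^ 2 / 3 ≤ (S - t₀) ^ 2 * Real.exp (-(‖y₀‖ ^ 2 / (4 * (S - t₀)))) := by
    have hsq : S ^ 2 ≤ (S - t₀) ^ 2 := pow_le_pow_left₀ hS0.le hSt 2
    calc S ^ 2 / 3 = S ^ 2 * (1 / 3) := by ring
      _ ≤ (S - t₀) ^ 2 * Real.exp (-(‖y₀‖ ^ 2 / (4 * (S - t₀)))) :=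
          mul_le_mul hsq hexp (by norm_num) (by positivity)
  -- `|χ| S²/3 ≤ 4C′S√(2S) ≤ 6C′S√S` and `18C′ ≤ δ√S`
  have hsqS : Real.sqrt S * Real.sqrt S = S := Real.mul_self_sqrt hS0.le
  have hsqS0 : 0 < Real.sqrt S := Real.sqrt_pos.2 hS0
  have hsqrt2 : Real.sqrt 2 ≤ 3 / 2 := by
    rw [show (3 / 2 : ℝ) = Real.sqrt ((3 / 2) ^ 2) by rw [Real.sqrt_sq (by norm_num)]]
    exact Real.sqrt_le_sqrt (by norm_num)
  have h2S : Real.sqrt (2 * S) = Real.sqrt 2 * Real.sqrt S := Real.sqrt_mul (by norm_num) S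
  have h18 : 18 * C' ≤ δ * Real.sqrt S := by
    have h1 : Real.sqrt ((18 * C' / δ) ^ 2) ≤ Real.sqrt S := Real.sqrt_le_sqrt hSC
    rw [Real.sqrt_sq (by positivity)] at h1
    have := mul_le_mul_of_nonneg_left h1 hδ.le
    rwa [mul_div_cancel₀ _ hδ.ne'] at this
  have hmain : |χ t₀ y₀| * (S ^ 2 / 3) ≤ 6 * C' * S * Real.sqrt S := by
    calc |χ t₀ y₀| * (S ^ 2 / 3)
        ≤ |χ t₀ y₀| * ((S - t₀) ^ 2 * Real.exp (-(‖y₀‖ ^ 2 / (4 * (S - t₀))))) :=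
          mul_le_mul_of_nonneg_left hw (abs_nonneg _)
      _ ≤ 4 * C' * S * Real.sqrt (2 * S) := hb
      _ = 4 * C' * S * (Real.sqrt 2 * Real.sqrt S) := by rw [h2S]
      _ ≤ 4 * C' * S * ((3 / 2) * Real.sqrt S) := by gcongr
      _ = 6 * C' * S * Real.sqrt S := by ring
  -- conclude
  have hfin : |χ t₀ y₀| * S ^ 2 ≤ δ * S ^ 2 := by
    calc |χ t₀ y₀| * S ^ 2 = 3 * (|χ t₀ y₀| * (S ^ 2 / 3)) := by ring
      _ ≤ 3 * (6 * C' * S * Real.sqrt S) := by linarith [hmain]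
      _ = (18 * C') * (S * Real.sqrt S) := by ring
      _ ≤ (δ * Real.sqrt S) * (S * Real.sqrt S) := mul_le_mul_of_nonneg_right h18 (by positivity)
      _ = δ * S ^ 2 := by rw [show δ * Real.sqrt S * (S * Real.sqrt S) = δ * S * (Real.sqrt S * Real.sqrt S) by ring, hsqS]; ring
  exact le_of_mul_le_mul_right hfin (by positivity)

end Summit.NavierStokesRegularity.NavierStokesRegularity.Theorems.ImplosionDoorPassiveRadialVorticityStubFarPastWashout

end
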